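import Literature.AnabelianGeometry.AbsoluteAnabelian.ArchimedeanReconstruction

/-!
# FACT-LIST row F-0058 `EllipticallyAdmissibleOverNFIsStrictlyBelyi` ([AbsTopIII] Rmk 2.8.3) — kernel status

PROOF-ONLY companion (abc-iut cell, seat abc-iut-w4-d104 gen 6; D-0079 L-F sub-cell [AbsTop*]+[AbsAnab], row
«LF-ABSTOP F-0058», L4-lead GO 2026-08-26T16:5xZ) of `ArchimedeanReconstruction.lean` (abc-iut-L4 lineage,
p408225 / v2 p414800, FROZEN; imported, never edited or restated) for the FROZEN FACT-LIST row of
S. Mochizuki, *Topics in Absolute Anabelian Geometry III* [AbsTopIII], Remark 2.8.3, kurims manuscript p. 64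
(lit key `paper:url-5493eb38cbb7`): «One verifies immediately that any elliptically admissible hyperbolic
orbicurve defined over a number field is of strictly Belyi type [cf. [AbsTopII], Definition 3.5 …]».

The row is TYPED as a SCHEMA over an abstract type of curves and THREE PREDICATE PARAMETERS
(`IsEllipticallyAdmissible`, `IsStrictlyBelyiType`, `IsDefinedOverNF : Curve → Prop`), i.e. it is the bare
implication family `∀ X, IsNF X → IsEA X → IsSB X` (`ellipticallyAdmissibleOverNFIsStrictlyBelyi_iff`).  This
file records its complete kernel status AS TYPED:

1. UNIVERSAL CLOSURE over the predicate parameters REFUTED (`not_forall_ellipticallyAdmissibleOverNFIsStrictlyBelyi`: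
   one curve, everything elliptically admissible and defined over an NF, nothing strictly Belyi) — the closure of
   a schema over free predicates is never a fact (plan R5);
2. VACUOUS INSTANCE FORMS PROVED — the two degenerate predicate choices that the tree's `CurveModel` shadows use
   (`IsStrictlyBelyiType := fun _ => True`, or an empty elliptically-admissible locus), and the monotonicity of
   the schema in its conclusion predicate.

The printed content (elliptic admissibility ⟹ strictly Belyi type, via Belyi maps, [AbsTopII] §3) is FACT-policy
and is NOT discharged here; a genuine carrier (an NF-curve type with CONTENTFUL «elliptically admissible» /
«strictly Belyi type» predicates) is not constructible in the tree today (E-list).  HONEST FRAMING: statements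
about OUR typed interface of a refereed prerequisite paper; no bearing on, and no side taken on, [IUTchIII]
Cor 3.12; typed ≠ proved; a FACT-LIST row is an assumption label, not an endorsement.
-/

namespace Literature.AnabelianGeometry.AbsoluteAnabelian.ArchimedeanReconstruction

universe u

/-- F-0058 UNFOLDED: the typed Rmk 2.8.3 schema is literally the implication family
«defined over an NF → elliptically admissible → strictly Belyi type» over its three predicate parameters
([AbsTopIII] Rmk 2.8.3 p. 64). [cite: MochizukiAbsTopIII2015, Remark 2.8.3 p.64] -/
theorem ellipticallyAdmissibleOverNFIsStrictlyBelyi_iff (Curve : Type u)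
    (IsEllipticallyAdmissible IsStrictlyBelyiType IsDefinedOverNF : Curve → Prop) :
    EllipticallyAdmissibleOverNFIsStrictlyBelyi Curve IsEllipticallyAdmissible IsStrictlyBelyiType
        IsDefinedOverNF ↔
      ∀ X, IsDefinedOverNF X → IsEllipticallyAdmissible X → IsStrictlyBelyiType X :=
  Iff.rfl

/-- **F-0058, UNIVERSAL CLOSURE REFUTED** (closed form, kernel): the schema does NOT hold for every curve type
and every choice of the three predicates — witness `Curve := PUnit`, everything elliptically admissible and
defined over an NF, nothing of strictly Belyi type.  (Refuting the closure of a predicate schema says nothing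
about print: [AbsTopIII] Rmk 2.8.3 p. 64 concerns the GENUINE predicates.)
[cite: MochizukiAbsTopIII2015, Remark 2.8.3 p.64] -/
theorem not_forall_ellipticallyAdmissibleOverNFIsStrictlyBelyi :
    ¬ ∀ (Curve : Type u) (IsEllipticallyAdmissible IsStrictlyBelyiType IsDefinedOverNF : Curve → Prop),
      EllipticallyAdmissibleOverNFIsStrictlyBelyi Curve IsEllipticallyAdmissible IsStrictlyBelyiType
        IsDefinedOverNF :=
  fun h => h PUnit (fun _ => True) (fun _ => False) (fun _ => True) PUnit.unit trivial trivial

/-- F-0058, VACUOUS INSTANCE FORM (PROVED): the schema holds whenever EVERY curve is of strictly Belyi type —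
the degenerate choice `IsStrictlyBelyiType := fun _ => True` of the tree's `CurveModel` shadows
([AbsTopIII] Rmk 2.8.3 p. 64, instance form). [cite: MochizukiAbsTopIII2015, Remark 2.8.3 p.64] -/
theorem ellipticallyAdmissibleOverNFIsStrictlyBelyi_of_forall_isStrictlyBelyiType (Curve : Type u)
    (IsEllipticallyAdmissible IsStrictlyBelyiType IsDefinedOverNF : Curve → Prop)
    (h : ∀ X, IsStrictlyBelyiType X) :
    EllipticallyAdmissibleOverNFIsStrictlyBelyi Curve IsEllipticallyAdmissible IsStrictlyBelyiType
      IsDefinedOverNF :=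
  fun X _ _ => h X

/-- F-0058, VACUOUS INSTANCE FORM (PROVED): the schema holds whenever NO curve defined over an NF is
elliptically admissible (empty hypothesis locus) ([AbsTopIII] Rmk 2.8.3 p. 64, instance form).
[cite: MochizukiAbsTopIII2015, Remark 2.8.3 p.64] -/
theorem ellipticallyAdmissibleOverNFIsStrictlyBelyi_of_forall_not_isEllipticallyAdmissible (Curve : Type u)
    (IsEllipticallyAdmissible IsStrictlyBelyiType IsDefinedOverNF : Curve → Prop)
    (h : ∀ X, IsDefinedOverNF X → ¬ IsEllipticallyAdmissible X) :
    EllipticallyAdmissibleOverNFIsStrictlyBelyi Curve IsEllipticallyAdmissible IsStrictlyBelyiType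
      IsDefinedOverNF :=
  fun X hNF hEA => (h X hNF hEA).elim

/-- F-0058, MONOTONICITY (PROVED): the schema is inherited by any weaker conclusion predicate — if it holds
for `IsSB` and `IsSB X → IsSB' X` for all `X`, it holds for `IsSB'` ([AbsTopIII] Rmk 2.8.3 p. 64, schema
bookkeeping for consumers that coarsen «strictly Belyi type»). [cite: MochizukiAbsTopIII2015, Remark 2.8.3 p.64] -/
theorem EllipticallyAdmissibleOverNFIsStrictlyBelyi.mono {Curve : Type u}
    {IsEllipticallyAdmissible IsStrictlyBelyiType IsStrictlyBelyiType' IsDefinedOverNF : Curve → Prop}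
    (h : EllipticallyAdmissibleOverNFIsStrictlyBelyi Curve IsEllipticallyAdmissible IsStrictlyBelyiType
      IsDefinedOverNF)
    (hmono : ∀ X, IsStrictlyBelyiType X → IsStrictlyBelyiType' X) :
    EllipticallyAdmissibleOverNFIsStrictlyBelyi Curve IsEllipticallyAdmissible IsStrictlyBelyiType'
      IsDefinedOverNF :=
  fun X hNF hEA => hmono X (h X hNF hEA)

end Literature.AnabelianGeometry.AbsoluteAnabelian.ArchimedeanReconstruction
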